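import Mathlib.Analysis.SpecialFunctions.Gaussian.FourierTransform
import Mathlib.MeasureTheory.Measure.Haar.InnerProductSpace
import HarnessLib

/-!
# Route `SwapVirialDeficit` (YangMills): THE ISOTROPIC PLANE GAUSSIAN ON A DISC WITH SATURATION — `∫_{|v|≤R} e^{−κ|v|²} ≤ min(4R², π∕κ)` on `Fin 2 → ℝ`
# (cell ym-idea-1, skeleton ➎ v14, `stub_core_tip`, socket (hCore): letters-free bricks for the SOFT joint-tilt factor and the bounded relative-tilt factor of
# w3 g68's capped `(τ⃗, ρ⃗)` assembly (STATUS 2026-09-01 01:36Z: in a cap `|τ⃗|² ≤ 3`, `|ρ⃗|² ≤ 3`), LEAD rulings (B2)/(B3) 01:36Z; LEAD seat ym-line-sfw-p2 g100,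
# free-hands support of ⟨stmt-QuantumFields-24197⟩ `SwapVirialDeficit.SwapGluedStiffness`)

Mathlib-only.  The soft pair of the tip core is Gaussian with a SMALL curvature `κ = b·s_t²·c·h` on a BOUNDED tilt disc; its factor is `min(area, π∕κ)` and the
Gaussian value always dominates (an upper bound never needs the saturation), which is why the frozen binder keeps the full exponent `alpha L` (ruling (B2)).
* §1 `integral_exp_neg_mul_sq_fin_two` — `∫_{Fin 2 → ℝ} e^{−κ(v₀² + v₁²)} dv = π∕κ` (`κ > 0`; ✓`GaussianFourier.integral_rexp_neg_mul_sq_norm` on `EuclideanSpace ℝ (Fin 2)`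
  transported by ✓`PiLp.volume_preserving_toLp`), `integrable_exp_neg_mul_sq_fin_two`, `lintegral_exp_neg_mul_sq_fin_two` (the `ℝ≥0∞` form);
* §2 `volume_disc_fin_two_le` — `vol{v₀² + v₁² ≤ R²} ≤ (2R)²` (the disc sits in the square), `measurableSet_disc_fin_two`;
* §3 ★ `setLIntegral_disc_exp_neg_mul_sq_le_min` — `∫⁻_{v₀²+v₁² ≤ R²} e^{−κ(v₀²+v₁²)} ≤ min((2R)², π∕κ)` (`κ > 0`, `R ≥ 0`), and the comparison form
  ★ `setLIntegral_disc_le_min_of_le_exp` for any `f ≤ e^{−κ|v|²}` on the disc (no measurability of `f` needed); `lintegral_le_of_le_exp_neg_mul_sq` (whole plane, `≤ π∕κ`);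
* §4 bookkeeping for the Profile currency: `min_le_add_div_one_add` (`min(a, c∕x) ≤ (a + c)∕(1 + x)`) and its `ℝ≥0∞` reading.  (The exponential
  saturations `e^{−x} ≤ 1∕(1+x)`, `≤ x⁻¹`, `≤ 2∕x²` are already in the tree: ✓`Literature.Probability.LatticeModels.SixVertex.exp_neg_le_one_div_add`,
  ✓`Literature.Barriers.RiemannHypothesis.Hamburger1921.exp_neg_le_inv`, ✓`Literature.NumberTheory.Automorphic.exp_neg_le_two_div_sq`,
  ✓`SigmaBall.exp_neg_le_two_div_one_add_sq`.)

HONEST LABEL: elementary Gaussian calculus; `stub_core_tip`, ⟨24197⟩ ∕ ⟨24194⟩ OPEN; own crux ⟨22884⟩ `LargeFieldMassRefinementTail` OPEN (blocked-on ⟨19935⟩); the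
Yang–Mills mass gap is NOT proved; no summit is proved by a line.  THEOREMS ONLY (0 `def`, 0 `sorry`, no instance, no notation), standard axioms.
`--supports stmt-QuantumFields-24197`.  References: [folklore].
-/

set_option autoImplicit false

noncomputable section

open MeasureTheory Set Real
open scoped ENNReal

namespace Summit.QuantumFields.YangMills.Theorems.QuantitativeLaplace

/-! ## §1 The isotropic plane Gaussian -/

/-- `‖toLp 2 v‖² = v₀² + v₁²` on `EuclideanSpace ℝ (Fin 2)`. [folklore] -/
theorem norm_sq_toLp_fin_two (v : Fin 2 → ℝ) : ‖(WithLp.toLp 2 v : EuclideanSpace ℝ (Fin 2))‖ ^ 2 = v 0 ^ 2 + v 1 ^ 2 := by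
  rw [EuclideanSpace.real_norm_sq_eq, Fin.sum_univ_two]

/-- ★ §1 `∫_{Fin 2 → ℝ} e^{−κ(v₀² + v₁²)} dv = π∕κ` for `κ > 0`. [folklore] -/
theorem integral_exp_neg_mul_sq_fin_two {κ : ℝ} (hκ : 0 < κ) :
    ∫ v : Fin 2 → ℝ, Real.exp (-(κ * (v 0 ^ 2 + v 1 ^ 2))) = π / κ := by
  set f : EuclideanSpace ℝ (Fin 2) → ℝ := fun w => Real.exp (-κ * ‖w‖ ^ 2) with hf
  have h := (PiLp.volume_preserving_toLp (Fin 2)).integral_comp (MeasurableEquiv.toLp 2 (Fin 2 → ℝ)).measurableEmbedding f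
  have key : ∀ v : Fin 2 → ℝ, f (WithLp.toLp 2 v) = Real.exp (-(κ * (v 0 ^ 2 + v 1 ^ 2))) := by
    intro v
    rw [hf]
    simp only [norm_sq_toLp_fin_two, neg_mul]
  have h' : ∫ v : Fin 2 → ℝ, Real.exp (-(κ * (v 0 ^ 2 + v 1 ^ 2))) = ∫ w : EuclideanSpace ℝ (Fin 2), f w := by
    rw [← h]
    exact integral_congr_ae (Filter.Eventually.of_forall fun v => (key v).symm)
  rw [h', hf, GaussianFourier.integral_rexp_neg_mul_sq_norm hκ, finrank_euclideanSpace, Fintype.card_fin]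
  norm_num

/-- The plane Gaussian is integrable (`κ > 0`). [folklore] -/
theorem integrable_exp_neg_mul_sq_fin_two {κ : ℝ} (hκ : 0 < κ) :
    Integrable fun v : Fin 2 → ℝ => Real.exp (-(κ * (v 0 ^ 2 + v 1 ^ 2))) := by
  have hpos : 0 < ∫ v : Fin 2 → ℝ, Real.exp (-(κ * (v 0 ^ 2 + v 1 ^ 2))) := by
    rw [integral_exp_neg_mul_sq_fin_two hκ]; positivity
  by_contra h
  rw [integral_undef h] at hpos
  exact lt_irrefl _ hpos

/-- §1 in `ℝ≥0∞`: `∫⁻ e^{−κ(v₀² + v₁²)} = ofReal(π∕κ)` (`κ > 0`). [folklore] -/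
theorem lintegral_exp_neg_mul_sq_fin_two {κ : ℝ} (hκ : 0 < κ) :
    ∫⁻ v : Fin 2 → ℝ, ENNReal.ofReal (Real.exp (-(κ * (v 0 ^ 2 + v 1 ^ 2)))) = ENNReal.ofReal (π / κ) := by
  rw [← integral_exp_neg_mul_sq_fin_two hκ,
    ofReal_integral_eq_lintegral_ofReal (integrable_exp_neg_mul_sq_fin_two hκ) (Filter.Eventually.of_forall fun v => (Real.exp_pos _).le)]

/-- Whole-plane comparison form: `f ≤ e^{−κ|v|²}` pointwise ⟹ `∫⁻ f ≤ ofReal(π∕κ)` (no measurability of `f` needed). [folklore] -/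
theorem lintegral_le_of_le_exp_neg_mul_sq {κ : ℝ} (hκ : 0 < κ) {f : (Fin 2 → ℝ) → ℝ≥0∞}
    (hf : ∀ v, f v ≤ ENNReal.ofReal (Real.exp (-(κ * (v 0 ^ 2 + v 1 ^ 2))))) :
    ∫⁻ v : Fin 2 → ℝ, f v ≤ ENNReal.ofReal (π / κ) := by
  rw [← lintegral_exp_neg_mul_sq_fin_two hκ]
  exact lintegral_mono hf

/-! ## §2 The tilt disc -/

/-- The disc `{v₀² + v₁² ≤ R²}` is measurable. [folklore] -/
theorem measurableSet_disc_fin_two (R : ℝ) : MeasurableSet {v : Fin 2 → ℝ | v 0 ^ 2 + v 1 ^ 2 ≤ R ^ 2} :=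
  measurableSet_le (by fun_prop) (by fun_prop)

/-- The disc sits in the square: `{v₀² + v₁² ≤ R²} ⊆ [−R, R]²` (`R ≥ 0`). [folklore] -/
theorem disc_fin_two_subset_pi_Icc {R : ℝ} (hR : 0 ≤ R) :
    {v : Fin 2 → ℝ | v 0 ^ 2 + v 1 ^ 2 ≤ R ^ 2} ⊆ Set.pi Set.univ fun _ : Fin 2 => Icc (-R) R := by
  intro v hv
  simp only [mem_setOf_eq] at hv
  have h0 : v 0 ^ 2 ≤ R ^ 2 := by nlinarith [sq_nonneg (v 1)]
  have h1 : v 1 ^ 2 ≤ R ^ 2 := by nlinarith [sq_nonneg (v 0)]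
  have a0 : |v 0| ≤ R := abs_le_of_sq_le_sq' h0 hR |>.elim (fun h h' => abs_le.2 ⟨h, h'⟩)
  have a1 : |v 1| ≤ R := abs_le_of_sq_le_sq' h1 hR |>.elim (fun h h' => abs_le.2 ⟨h, h'⟩)
  intro i _
  fin_cases i
  · exact ⟨(abs_le.1 a0).1, (abs_le.1 a0).2⟩
  · exact ⟨(abs_le.1 a1).1, (abs_le.1 a1).2⟩

/-- §2 `vol{v₀² + v₁² ≤ R²} ≤ ofReal((2R)²)` on `Fin 2 → ℝ` (`R ≥ 0`). [folklore] -/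
theorem volume_disc_fin_two_le {R : ℝ} (hR : 0 ≤ R) :
    volume {v : Fin 2 → ℝ | v 0 ^ 2 + v 1 ^ 2 ≤ R ^ 2} ≤ ENNReal.ofReal ((2 * R) ^ 2) := by
  calc volume {v : Fin 2 → ℝ | v 0 ^ 2 + v 1 ^ 2 ≤ R ^ 2}
      ≤ volume (Set.pi Set.univ fun _ : Fin 2 => Icc (-R) R) := measure_mono (disc_fin_two_subset_pi_Icc hR)
    _ = ENNReal.ofReal ((2 * R) ^ 2) := by
        rw [volume_pi_pi]
        simp only [Real.volume_Icc, Finset.prod_const, Finset.card_univ, Fintype.card_fin]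
        rw [← ENNReal.ofReal_pow (by linarith)]
        congr 1
        ring

/-! ## §3 The disc Gaussian with saturation -/

/-- ★ §3 THE SOFT-TILT FACTOR: `∫⁻_{v₀²+v₁² ≤ R²} e^{−κ(v₀²+v₁²)} ≤ min(ofReal((2R)²), ofReal(π∕κ))` (`κ > 0`, `R ≥ 0`) — the Gaussian value `π∕κ` saturated
by the area of the tilt disc. [folklore] -/
theorem setLIntegral_disc_exp_neg_mul_sq_le_min {κ R : ℝ} (hκ : 0 < κ) (hR : 0 ≤ R) :
    ∫⁻ v in {v : Fin 2 → ℝ | v 0 ^ 2 + v 1 ^ 2 ≤ R ^ 2}, ENNReal.ofReal (Real.exp (-(κ * (v 0 ^ 2 + v 1 ^ 2)))) ≤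
      min (ENNReal.ofReal ((2 * R) ^ 2)) (ENNReal.ofReal (π / κ)) := by
  refine le_min ?_ ?_
  · calc ∫⁻ v in {v : Fin 2 → ℝ | v 0 ^ 2 + v 1 ^ 2 ≤ R ^ 2}, ENNReal.ofReal (Real.exp (-(κ * (v 0 ^ 2 + v 1 ^ 2))))
        ≤ ∫⁻ _ in {v : Fin 2 → ℝ | v 0 ^ 2 + v 1 ^ 2 ≤ R ^ 2}, (1 : ℝ≥0∞) := by
          refine lintegral_mono fun v => ?_
          rw [← ENNReal.ofReal_one]
          exact ENNReal.ofReal_le_ofReal (Real.exp_le_one_iff.2 (by nlinarith [sq_nonneg (v 0), sq_nonneg (v 1)]))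
      _ = volume {v : Fin 2 → ℝ | v 0 ^ 2 + v 1 ^ 2 ≤ R ^ 2} := by rw [setLIntegral_one]
      _ ≤ ENNReal.ofReal ((2 * R) ^ 2) := volume_disc_fin_two_le hR
  · calc ∫⁻ v in {v : Fin 2 → ℝ | v 0 ^ 2 + v 1 ^ 2 ≤ R ^ 2}, ENNReal.ofReal (Real.exp (-(κ * (v 0 ^ 2 + v 1 ^ 2))))
        ≤ ∫⁻ v : Fin 2 → ℝ, ENNReal.ofReal (Real.exp (-(κ * (v 0 ^ 2 + v 1 ^ 2)))) := setLIntegral_le_lintegral _ _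
      _ = ENNReal.ofReal (π / κ) := lintegral_exp_neg_mul_sq_fin_two hκ

/-- ★ The comparison form on the disc: `f ≤ e^{−κ|v|²}` on the disc ⟹ `∫⁻_{disc} f ≤ min(ofReal((2R)²), ofReal(π∕κ))` (no measurability of `f`). [folklore] -/
theorem setLIntegral_disc_le_min_of_le_exp {κ R : ℝ} (hκ : 0 < κ) (hR : 0 ≤ R) {f : (Fin 2 → ℝ) → ℝ≥0∞}
    (hf : ∀ v : Fin 2 → ℝ, v 0 ^ 2 + v 1 ^ 2 ≤ R ^ 2 → f v ≤ ENNReal.ofReal (Real.exp (-(κ * (v 0 ^ 2 + v 1 ^ 2))))) :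
    ∫⁻ v in {v : Fin 2 → ℝ | v 0 ^ 2 + v 1 ^ 2 ≤ R ^ 2}, f v ≤ min (ENNReal.ofReal ((2 * R) ^ 2)) (ENNReal.ofReal (π / κ)) :=
  (setLIntegral_mono' (measurableSet_disc_fin_two R) fun v hv => hf v hv).trans (setLIntegral_disc_exp_neg_mul_sq_le_min hκ hR)

/-- The area-only form (any `κ`, e.g. `κ = 0`): `f ≤ 1` on the disc ⟹ `∫⁻_{disc} f ≤ ofReal((2R)²)`. [folklore] -/
theorem setLIntegral_disc_le_sq_of_le_one {R : ℝ} (hR : 0 ≤ R) {f : (Fin 2 → ℝ) → ℝ≥0∞}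
    (hf : ∀ v : Fin 2 → ℝ, v 0 ^ 2 + v 1 ^ 2 ≤ R ^ 2 → f v ≤ 1) :
    ∫⁻ v in {v : Fin 2 → ℝ | v 0 ^ 2 + v 1 ^ 2 ≤ R ^ 2}, f v ≤ ENNReal.ofReal ((2 * R) ^ 2) := by
  calc ∫⁻ v in {v : Fin 2 → ℝ | v 0 ^ 2 + v 1 ^ 2 ≤ R ^ 2}, f v
      ≤ ∫⁻ _ in {v : Fin 2 → ℝ | v 0 ^ 2 + v 1 ^ 2 ≤ R ^ 2}, (1 : ℝ≥0∞) := setLIntegral_mono' (measurableSet_disc_fin_two R) fun v hv => hf v hv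
    _ = volume {v : Fin 2 → ℝ | v 0 ^ 2 + v 1 ^ 2 ≤ R ^ 2} := by rw [setLIntegral_one]
    _ ≤ ENNReal.ofReal ((2 * R) ^ 2) := volume_disc_fin_two_le hR

/-! ## §4 Bookkeeping for the Profile currency -/

/-- `min(a, c∕x) ≤ (a + c)∕(1 + x)` for `x > 0` (any real `a, c`) — the saturated-or-Gaussian factor in ONE rational expression. [folklore] -/
theorem min_le_add_div_one_add (a c : ℝ) {x : ℝ} (hx : 0 < x) : min a (c / x) ≤ (a + c) / (1 + x) := by
  have h1x : 0 < 1 + x := by linarith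
  rcases le_or_gt (a * x) c with h | h
  · -- `a ≤ c/x`: the min is `≤ a ≤ (a+c)/(1+x)`
    calc min a (c / x) ≤ a := min_le_left _ _
      _ ≤ (a + c) / (1 + x) := by rw [le_div_iff₀ h1x]; nlinarith
  · -- `c/x < a`: the min is `≤ c/x ≤ (a+c)/(1+x)`
    calc min a (c / x) ≤ c / x := min_le_right _ _
      _ ≤ (a + c) / (1 + x) := by rw [div_le_div_iff₀ hx h1x]; nlinarith

/-- The `ℝ≥0∞` reading of the same inequality. [folklore] -/
theorem min_ofReal_le_ofReal_add_div_one_add (a c : ℝ) {x : ℝ} (hx : 0 < x) :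
    min (ENNReal.ofReal a) (ENNReal.ofReal (c / x)) ≤ ENNReal.ofReal ((a + c) / (1 + x)) := by
  rw [← ENNReal.ofReal_min]
  exact ENNReal.ofReal_le_ofReal (min_le_add_div_one_add a c hx)

end Summit.QuantumFields.YangMills.Theorems.QuantitativeLaplace

end
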